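import Mathlib.FieldTheory.IsAlgClosed.Basic
import Mathlib.RingTheory.Flat.TorsionFree
import Mathlib.RingTheory.Flat.Basic
import Mathlib.LinearAlgebra.TensorProduct.Pi
import Mathlib.RingTheory.Localization.FractionRing
import Mathlib.LinearAlgebra.FreeModule.PID
import Literature.RingTheory.DiscreteValuationRing.DeligneSerreLiftingProofs
import HarnessLib

/-!
# Deligne–Serre 1974, 6.10: lifting a mod-`𝔪` eigenvector of integral operators

Deligne–Serre, *Formes modulaires de poids 1*, Ann. Sci. ÉNS (4) 7 (1974), 6.10 (p. 522):
"RÉDUCTION AU CAS OÙ `f` EST VECTEUR PROPRE DES `T_p`. — Il suffit de vérifier qu'il existe `f'`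
comme en 6.8 [`a_p ≡ a'_p (mod λ')`], avec `(k', ε') = (k, ε)`, et vecteur propre des `T_p`.
Cela résulte du lemme suivant [Lemme 6.11], appliqué aux `T_p` agissant sur le `𝒪_λ`-module `M`
des formes modulaires de type `(k, ε)` sur `Γ₀(N)`, à coefficients dans `𝒪_λ`."

This file PROVES the abstract form of this reduction, from the tree's proof of Lemme 6.11
(`Literature.RingTheory.DiscreteValuationRing.DeligneSerre1974.lemma611_holds`). The setting
abstracts "forms with coefficients in `𝒪_λ`": `𝒪` is a discrete valuation ring mapping
injectively to an algebraically closed field `C` (`𝒪_λ ⊆ ℂ`), `V` a `C`-vector space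
(`S_k(Γ₁(N))`) with "coefficient" functionals `c m : V → C` (`m`-th Fourier coefficient) which
separate the points of a subspace `W` (`S_k(N, ε)`) using finitely many indices (`m < B`, the
Sturm bound), and `𝒯` a commuting family of operators of `V` preserving `W` and the
`𝒪`-integrality of coefficients (the `T_p`). The `𝒪`-module `M = {v ∈ W | c m v ∈ 𝒪 ∀ m}` is
then finite free (it embeds in `𝒪^B`), and a vector `x ∈ M` with a unit coefficient which is an
eigenvector of the `T ∈ 𝒯` modulo `𝔪` (coefficientwise: `c m (T x) - a_T c m x ∈ 𝔪`) is a
non-zero common eigenvector of `M / 𝔪 M`; Lemme 6.11 lifts the eigenvalues `a_T mod 𝔪` to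
eigenvalues `a'_T ∈ 𝒪'` of a genuine common eigenvector in `𝒪' ⊗_𝒪 M`, for a discrete
valuation ring `𝒪' ⊇ 𝒪` with fraction field `K'` finite over `Frac 𝒪`; embedding `K'` into `C`
over `𝒪` (`C` is algebraically closed) turns it into a non-zero common eigenvector `g ∈ W ⊆ V`
with eigenvalues the images of the `a'_T`, `a'_T ≡ a_T (mod 𝔪')`.

* `Literature.RingTheory.DiscreteValuationRing.DeligneSerre1974.exists_eigenvector_lift` — the
  statement just described.

## References

* P. Deligne, J.-P. Serre, *Formes modulaires de poids 1*, Ann. Sci. ÉNS (4) 7 (1974), 6.10,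
  Lemme 6.11.
-/

universe u

open scoped TensorProduct

open IsLocalRing Module

namespace Literature.RingTheory.DiscreteValuationRing.DeligneSerre1974

section Setting

variable {𝒪 : Type u} [CommRing 𝒪] [IsDomain 𝒪] [IsDiscreteValuationRing 𝒪]
variable {C : Type u} [Field C] [Algebra 𝒪 C]
variable {V : Type u} [AddCommGroup V] [Module C V] [Module 𝒪 V] [IsScalarTower 𝒪 C V]

omit [IsDomain 𝒪] [IsDiscreteValuationRing 𝒪] in
/-- An element of `V` all of whose coefficients lie in `𝔪 = (π)` and which lies in `W` is `π`
times an element of `W` with coefficients in `𝒪`. [folklore] -/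
private lemma exists_eq_smul_of_coeff_mem (hinj : Function.Injective (algebraMap 𝒪 C))
    (W : Submodule C V) (c : ℕ → (V →ₗ[C] C)) {π : 𝒪} (hπ : π ≠ 0)
    {z : V} (hzW : z ∈ W) (hz : ∀ m, ∃ w : 𝒪, c m z = algebraMap 𝒪 C (π * w)) :
    ∃ z' : V, z' ∈ W ∧ (∀ m, c m z' ∈ (algebraMap 𝒪 C).range) ∧ z = π • z' := by
  have hπC : algebraMap 𝒪 C π ≠ 0 := fun h ↦ hπ (hinj (by rw [h, map_zero]))
  refine ⟨(algebraMap 𝒪 C π)⁻¹ • z, W.smul_mem _ hzW, fun m ↦ ?_, ?_⟩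
  · obtain ⟨w, hw⟩ := hz m
    refine ⟨w, ?_⟩
    rw [map_smul, hw, smul_eq_mul, map_mul, ← mul_assoc, inv_mul_cancel₀ hπC, one_mul]
  · rw [← IsScalarTower.algebraMap_smul C π, smul_smul, mul_inv_cancel₀ hπC, one_smul]

/-- **Deligne–Serre 1974, 6.10 (abstract form): lifting a mod-`𝔪` eigenvector.** See the module
docstring for the dictionary with the printed text. Hypotheses: `𝒪` a discrete valuation ring
with `𝒪 → C` injective into an algebraically closed field; `W ⊆ V` a `C`-subspace on which the
coefficient functionals `c m`, `m < B`, are jointly injective; `𝒯` pairwise commuting operators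
of `V` preserving `W` and the `𝒪`-integrality of all coefficients on `W`; `x ∈ W` with integral
coefficients, `c m₀ x = 1`, and `c m (T x) - a_T · c m x ∈ 𝔪` for all `T ∈ 𝒯`, `m`. Conclusion:
a discrete valuation ring `𝒪' ⊇ 𝒪` (`𝔪' ∩ 𝒪 = 𝔪`) with fraction field `K'` finite over
`Frac 𝒪`, an embedding `e : K' → C` over `𝒪`, eigenvalues `a'_T ∈ 𝒪'` with
`a'_T ≡ a_T (mod 𝔪')`, and a non-zero `g ∈ W` with `T g = e(a'_T) g` for all `T ∈ 𝒯`.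
[cite: DeligneSerreASENS1974, 6.10 and Lemme 6.11] -/
theorem exists_eigenvector_lift [IsAlgClosed C] (hinj : Function.Injective (algebraMap 𝒪 C))
    (W : Submodule C V) (c : ℕ → (V →ₗ[C] C)) (B : ℕ)
    (hc : ∀ v ∈ W, (∀ m < B, c m v = 0) → v = 0)
    (𝒯 : Set (V →ₗ[C] V)) (hcomm : ∀ S ∈ 𝒯, ∀ T ∈ 𝒯, Commute S T)
    (hW : ∀ T ∈ 𝒯, ∀ v ∈ W, T v ∈ W)
    (hint : ∀ T ∈ 𝒯, ∀ v ∈ W, (∀ m, c m v ∈ (algebraMap 𝒪 C).range) →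
      ∀ m, c m (T v) ∈ (algebraMap 𝒪 C).range)
    (x : V) (hxW : x ∈ W) (hx : ∀ m, c m x ∈ (algebraMap 𝒪 C).range) (m₀ : ℕ) (hx1 : c m₀ x = 1)
    (a : (V →ₗ[C] V) → 𝒪)
    (hcongr : ∀ T ∈ 𝒯, ∀ m,
      c m (T x) - algebraMap 𝒪 C (a T) * c m x ∈ algebraMap 𝒪 C '' (maximalIdeal 𝒪)) :
    ∃ (K' : Type u) (_ : Field K') (_ : Algebra 𝒪 K') (_ : Algebra (FractionRing 𝒪) K')
      (_ : IsScalarTower 𝒪 (FractionRing 𝒪) K') (_ : FiniteDimensional (FractionRing 𝒪) K')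
      (𝒪' : Type u) (_ : CommRing 𝒪') (_ : IsDomain 𝒪') (_ : IsDiscreteValuationRing 𝒪')
      (_ : Algebra 𝒪 𝒪') (_ : Algebra 𝒪' K') (_ : IsScalarTower 𝒪 𝒪' K')
      (_ : IsFractionRing 𝒪' K') (e : K' →+* C),
      (maximalIdeal 𝒪').comap (algebraMap 𝒪 𝒪') = maximalIdeal 𝒪 ∧
      (∀ y : 𝒪, e (algebraMap 𝒪 K' y) = algebraMap 𝒪 C y) ∧
      ∃ (a' : (V →ₗ[C] V) → 𝒪') (g : V), g ≠ 0 ∧ g ∈ W ∧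
        (∀ T ∈ 𝒯, T g = e (algebraMap 𝒪' K' (a' T)) • g) ∧
        ∀ T ∈ 𝒯, a' T - algebraMap 𝒪 𝒪' (a T) ∈ maximalIdeal 𝒪' := by
  classical
  -- ### the `𝒪`-module `M = {v ∈ W | all coefficients in `𝒪`}`
  let Rng : Submodule 𝒪 C := LinearMap.range (Algebra.linearMap 𝒪 C)
  have hRng : ∀ t : C, t ∈ Rng ↔ t ∈ (algebraMap 𝒪 C).range := fun t ↦ by
    simp only [Rng, LinearMap.mem_range, Algebra.linearMap_apply, RingHom.mem_range]
  let M : Submodule 𝒪 V :=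
    (W.restrictScalars 𝒪) ⊓ ⨅ m, Rng.comap ((c m).restrictScalars 𝒪)
  have hM : ∀ v : V, v ∈ M ↔ v ∈ W ∧ ∀ m, c m v ∈ (algebraMap 𝒪 C).range := fun v ↦ by
    simp only [M, Submodule.mem_inf, Submodule.restrictScalars_mem, Submodule.mem_iInf,
      Submodule.mem_comap, LinearMap.coe_restrictScalars, hRng]
  have hxM : x ∈ M := (hM x).mpr ⟨hxW, hx⟩
  -- torsion-freeness of `V` over `𝒪`
  haveI : NoZeroSMulDivisors 𝒪 V := by
    refine ⟨fun {r v} h ↦ ?_⟩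
    by_cases hr : r = 0
    · exact Or.inl hr
    · right
      rw [← IsScalarTower.algebraMap_smul C r] at h
      exact (smul_eq_zero.mp h).resolve_left fun h' ↦ hr (hinj (by rw [h', map_zero]))
  -- ### coefficient functionals `γ m : M → 𝒪`
  let eR : 𝒪 ≃ₗ[𝒪] Rng := LinearEquiv.ofInjective (Algebra.linearMap 𝒪 C) hinj
  have hγ_aux : ∀ (m : ℕ) (v : M), c m (v : V) ∈ Rng := fun m v ↦
    (hRng _).mpr (((hM v).mp v.2).2 m)
  let γ : ℕ → (M →ₗ[𝒪] 𝒪) := fun m ↦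
    eR.symm.toLinearMap ∘ₗ LinearMap.codRestrict Rng (((c m).restrictScalars 𝒪) ∘ₗ M.subtype)
      (fun v ↦ hγ_aux m v)
  have hγ : ∀ (m : ℕ) (v : M), algebraMap 𝒪 C (γ m v) = c m (v : V) := fun m v ↦ by
    have h1 : ((eR (γ m v) : Rng) : C) = algebraMap 𝒪 C (γ m v) := rfl
    rw [← h1]
    simp only [γ, LinearMap.coe_comp, LinearEquiv.coe_coe, Function.comp_apply,
      LinearEquiv.apply_symm_apply, LinearMap.codRestrict_apply, LinearMap.coe_restrictScalars,
      Submodule.coe_subtype]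
  -- joint injectivity on `M`
  let Γ : M →ₗ[𝒪] (Fin B → 𝒪) := LinearMap.pi fun i ↦ γ (i : ℕ)
  have hΓ : Function.Injective Γ := by
    rw [injective_iff_map_eq_zero]
    intro v hv
    have hvW : (v : V) ∈ W := ((hM v).mp v.2).1
    have : (v : V) = 0 := hc _ hvW fun m hm ↦ by
      have := congr_fun hv ⟨m, hm⟩
      simp only [Γ, LinearMap.pi_apply, Pi.zero_apply] at this
      rw [← hγ m v, this, map_zero]
    exact Subtype.ext this
  -- `M` is finite free over `𝒪`
  haveI : Module.Finite 𝒪 M := Module.Finite.of_injective Γ hΓ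
  haveI : Module.Free 𝒪 M := inferInstance
  -- ### the operators on `M`
  have hTM : ∀ T ∈ 𝒯, ∀ v ∈ M, T v ∈ M := fun T hT v hv ↦ by
    rw [hM] at hv ⊢
    exact ⟨hW T hT v hv.1, hint T hT v hv.1 hv.2⟩
  let res : 𝒯 → Module.End 𝒪 M := fun T ↦
    ((T : V →ₗ[C] V).restrictScalars 𝒪).restrict fun v hv ↦ hTM T T.2 v hv
  have hres : ∀ (T : 𝒯) (v : M), ((res T v : M) : V) = (T : V →ₗ[C] V) v := fun _ _ ↦ rfl
  let 𝒯M : Set (Module.End 𝒪 M) := Set.range res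
  have hcommM : ∀ S ∈ 𝒯M, ∀ T ∈ 𝒯M, Commute S T := by
    rintro _ ⟨S, rfl⟩ _ ⟨T, rfl⟩
    refine LinearMap.ext fun v ↦ Subtype.ext ?_
    change (S : V →ₗ[C] V) ((T : V →ₗ[C] V) v) = (T : V →ₗ[C] V) ((S : V →ₗ[C] V) v)
    exact congrArg (fun F : V →ₗ[C] V ↦ F v) (hcomm S S.2 T T.2).eq
  -- ### the mod-`𝔪` eigenvector `1 ⊗ x`
  let k := ResidueField 𝒪
  obtain ⟨π, hπirr⟩ := IsDiscreteValuationRing.exists_irreducible 𝒪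
  have hπmax : maximalIdeal 𝒪 = Ideal.span {π} := hπirr.maximalIdeal_eq
  have hπ0 : π ≠ 0 := hπirr.ne_zero
  let xM : M := ⟨x, hxM⟩
  let fbar : k ⊗[𝒪] M := (1 : k) ⊗ₜ xM
  -- `res T xM = a T • xM + π • z'`
  have hdecomp : ∀ T : 𝒯, ∃ z' : M, res T xM = a T • xM + π • z' := by
    intro T
    have hz : ∀ m, ∃ w : 𝒪, c m ((T : V →ₗ[C] V) x - algebraMap 𝒪 C (a T) • x) =
        algebraMap 𝒪 C (π * w) := by
      intro m
      obtain ⟨y, hy, hy'⟩ := hcongr T T.2 m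
      rw [SetLike.mem_coe, hπmax, Ideal.mem_span_singleton] at hy
      obtain ⟨w, rfl⟩ := hy
      refine ⟨w, ?_⟩
      rw [map_sub, map_smul, smul_eq_mul, ← hy']
    obtain ⟨z', hz'W, hz'int, hz'eq⟩ := exists_eq_smul_of_coeff_mem hinj W c hπ0
      (W.sub_mem (hW T T.2 x hxW) (W.smul_mem _ hxW)) hz
    refine ⟨⟨z', (hM z').mpr ⟨hz'W, hz'int⟩⟩, Subtype.ext ?_⟩
    change (T : V →ₗ[C] V) x = (a T • x + π • z' : V)
    rw [← hz'eq, ← IsScalarTower.algebraMap_smul C (a T), add_sub_cancel]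
  have hπres : algebraMap 𝒪 k π = 0 :=
    (residue_eq_zero_iff π).mpr (hπmax ▸ Ideal.mem_span_singleton_self π)
  have heigen : ∀ T : 𝒯, (res T).baseChange k fbar = residue 𝒪 (a T) • fbar := by
    intro T
    obtain ⟨z', hz'⟩ := hdecomp T
    have h1 : (res T).baseChange k fbar = (1 : k) ⊗ₜ (res T xM) :=
      LinearMap.baseChange_tmul _ _ _
    rw [h1, hz', TensorProduct.tmul_add, TensorProduct.tmul_smul, TensorProduct.tmul_smul,
      ← IsScalarTower.algebraMap_smul k π ((1 : k) ⊗ₜ[𝒪] z'), hπres, zero_smul, add_zero]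
    exact (IsScalarTower.algebraMap_smul k (a T) _).symm
  -- `fbar ≠ 0`: its `m₀`-th coefficient is `1`
  have hγx : γ m₀ xM = 1 := hinj (by rw [hγ, map_one]; exact hx1)
  have hfbar : fbar ≠ 0 := by
    intro h
    have h1 : (γ m₀).baseChange k fbar = 0 := by rw [h, map_zero]
    simp only [fbar, LinearMap.baseChange_tmul, hγx] at h1
    have h2 := congrArg (TensorProduct.rid 𝒪 k) h1 -- `k ⊗[𝒪] 𝒪 ≃ k`
    simp at h2
  -- the eigenvalue system on `End M`
  let α : Module.End 𝒪 M → k := fun F ↦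
    if h : ∃ T : 𝒯, res T = F then residue 𝒪 (a h.choose) else 0
  have hα : ∀ F ∈ 𝒯M, F.baseChange k fbar = α F • fbar := by
    rintro _ ⟨T, rfl⟩
    have h : ∃ T' : 𝒯, res T' = res T := ⟨T, rfl⟩
    simp only [α, dif_pos h]
    have := heigen h.choose
    rw [h.choose_spec] at this
    exact this
  have hαT : ∀ T : 𝒯, α (res T) = residue 𝒪 (a T) := by
    intro T
    have h1 := hα (res T) ⟨T, rfl⟩
    rw [heigen T] at h1
    exact (smul_left_injective k hfbar h1).symm
  -- ### Lemme 6.11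
  obtain ⟨K', _, _, _, _, _, 𝒪', _, _, _, _, _, _, _, hcomap, a'', f', hf'0, heig', hcong'⟩ :=
    lemma611_holds 𝒯M hcommM α fbar hfbar hα
  -- ### the embedding `e : K' → C` over `𝒪`
  letI : Algebra (FractionRing 𝒪) C := (IsFractionRing.lift hinj : FractionRing 𝒪 →+* C).toAlgebra
  haveI : Algebra.IsAlgebraic (FractionRing 𝒪) K' := Algebra.IsAlgebraic.of_finite _ _
  let eₐ : K' →ₐ[FractionRing 𝒪] C := IsAlgClosed.lift
  let e : K' →+* C := eₐ.toRingHom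
  have he : ∀ y : 𝒪, e (algebraMap 𝒪 K' y) = algebraMap 𝒪 C y := by
    intro y
    rw [IsScalarTower.algebraMap_apply 𝒪 (FractionRing 𝒪) K' y]
    change eₐ (algebraMap (FractionRing 𝒪) K' _) = _
    rw [AlgHom.commutes]
    exact IsFractionRing.lift_algebraMap hinj y
  -- injectivity of `𝒪 → 𝒪'`, flatness of `𝒪'`
  have hinj' : Function.Injective (algebraMap 𝒪 𝒪') := by
    intro y₁ y₂ h
    have h1 : algebraMap 𝒪 K' y₁ = algebraMap 𝒪 K' y₂ := by
      rw [IsScalarTower.algebraMap_apply 𝒪 𝒪' K', IsScalarTower.algebraMap_apply 𝒪 𝒪' K', h]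
    rw [IsScalarTower.algebraMap_apply 𝒪 (FractionRing 𝒪) K',
      IsScalarTower.algebraMap_apply 𝒪 (FractionRing 𝒪) K'] at h1
    exact IsFractionRing.injective 𝒪 (FractionRing 𝒪)
      ((algebraMap (FractionRing 𝒪) K').injective h1)
  haveI : Module.IsTorsionFree 𝒪 𝒪' := Module.isTorsionFree_iff_algebraMap_injective.mpr hinj'
  haveI : Module.Flat 𝒪 𝒪' := inferInstance
  -- ### complexification `Φ : 𝒪' ⊗ M → V`, `s ⊗ v ↦ e(s) • v`
  let ε : 𝒪' → C := fun s ↦ e (algebraMap 𝒪' K' s)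
  have hε_mul : ∀ s t, ε (s * t) = ε s * ε t := fun s t ↦ by simp [ε]
  have hε_alg : ∀ y : 𝒪, ε (algebraMap 𝒪 𝒪' y) = algebraMap 𝒪 C y := fun y ↦ by
    simp only [ε, ← IsScalarTower.algebraMap_apply, he]
  let Φ : 𝒪' ⊗[𝒪] M →ₗ[𝒪] V :=
    TensorProduct.lift
      { toFun := fun s ↦
          { toFun := fun v ↦ ε s • (v : V)
            map_add' := fun v w ↦ by simp [smul_add]
            map_smul' := fun r v ↦ by
              simp only [SetLike.val_smul, RingHom.id_apply]
              rw [smul_comm] }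
        map_add' := fun s t ↦ LinearMap.ext fun v ↦ by
          simp [ε, add_smul]
        map_smul' := fun r s ↦ LinearMap.ext fun v ↦ by
          simp only [Algebra.smul_def, hε_mul, hε_alg, LinearMap.coe_mk, AddHom.coe_mk,
            RingHom.id_apply, LinearMap.smul_apply, mul_smul, IsScalarTower.algebraMap_smul] }
  have hΦ : ∀ (s : 𝒪') (v : M), Φ (s ⊗ₜ v) = ε s • (v : V) := fun s v ↦ by
    simp [Φ]
  let g : V := Φ f'
  -- `Φ` lands in `W`
  have hΦW : ∀ t, Φ t ∈ W := fun t ↦ by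
    induction t using TensorProduct.induction_on with
    | zero => rw [map_zero]; exact W.zero_mem
    | tmul s v => rw [hΦ]; exact W.smul_mem _ ((hM v).mp v.2).1
    | add t₁ t₂ h₁ h₂ => rw [map_add]; exact W.add_mem h₁ h₂
  -- `Φ` intertwines `res T` and `T`, and the `𝒪'`-action with `ε`
  have hΦT : ∀ (T : 𝒯) (t : 𝒪' ⊗[𝒪] M),
      Φ ((res T).baseChange 𝒪' t) = (T : V →ₗ[C] V) (Φ t) := fun T t ↦ by
    induction t using TensorProduct.induction_on with
    | zero => simp
    | tmul s v => rw [LinearMap.baseChange_tmul, hΦ, hΦ, hres, LinearMap.map_smul]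
    | add t₁ t₂ h₁ h₂ => simp only [map_add, h₁, h₂]
  have hΦsmul : ∀ (s : 𝒪') (t : 𝒪' ⊗[𝒪] M), Φ (s • t) = ε s • Φ t := fun s t ↦ by
    induction t using TensorProduct.induction_on with
    | zero => simp
    | tmul s' v => rw [TensorProduct.smul_tmul', hΦ, hΦ, smul_eq_mul, hε_mul, mul_smul]
    | add t₁ t₂ h₁ h₂ => rw [smul_add, map_add, map_add, h₁, h₂, smul_add]
  -- coefficients of `Φ t`: `c m (Φ t) = ε (μ m t)` with `μ m = (γ m) ⊗ 𝒪'`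
  have hε_add : ∀ s t, ε (s + t) = ε s + ε t := fun s t ↦ by simp [ε]
  let μ : ℕ → (𝒪' ⊗[𝒪] M →ₗ[𝒪'] 𝒪') := fun m ↦
    (TensorProduct.AlgebraTensorModule.rid 𝒪 𝒪' 𝒪').toLinearMap ∘ₗ (γ m).baseChange 𝒪'
  have hμ : ∀ (m : ℕ) (s : 𝒪') (v : M), μ m (s ⊗ₜ v) = γ m v • s := fun m s v ↦ by
    simp [μ]
  have hcΦ : ∀ (m : ℕ) (t : 𝒪' ⊗[𝒪] M), c m (Φ t) = ε (μ m t) := fun m t ↦ by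
    induction t using TensorProduct.induction_on with
    | zero => simp [ε]
    | tmul s v =>
      rw [hΦ, hμ, map_smul, smul_eq_mul, ← hγ m v, ← hε_alg, ← hε_mul, Algebra.smul_def,
        mul_comm]
    | add t₁ t₂ h₁ h₂ => rw [map_add, map_add, map_add, hε_add, h₁, h₂]
  have hε_inj : ∀ s : 𝒪', ε s = 0 → s = 0 := fun s hs ↦ by
    have h1 : algebraMap 𝒪' K' s = 0 := e.injective (by rw [map_zero]; exact hs)
    exact (IsFractionRing.injective 𝒪' K') (by rw [h1, map_zero])
  -- ### `g ≠ 0` (flatness of `𝒪'` over `𝒪`)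
  have hg0 : g ≠ 0 := by
    intro hg
    -- `ν = (Γ ⊗ 𝒪') : 𝒪' ⊗ M → (Fin B → 𝒪')` is injective
    let ν : 𝒪' ⊗[𝒪] M →ₗ[𝒪'] (Fin B → 𝒪') :=
      (TensorProduct.piScalarRight 𝒪 𝒪' 𝒪' (Fin B)).toLinearMap ∘ₗ Γ.baseChange 𝒪'
    have hνinj : Function.Injective ν := by
      refine (TensorProduct.piScalarRight 𝒪 𝒪' 𝒪' (Fin B)).injective.comp ?_
      have := Module.Flat.lTensor_preserves_injective_linearMap (M := 𝒪') Γ hΓ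
      intro t₁ t₂ h
      exact this h
    have hν : ∀ (t : 𝒪' ⊗[𝒪] M) (i : Fin B), ν t i = μ (i : ℕ) t := fun t i ↦ by
      induction t using TensorProduct.induction_on with
      | zero => simp
      | tmul s v =>
        rw [hμ]
        simp [ν, TensorProduct.piScalarRight_apply, TensorProduct.piScalarRightHom_tmul, Γ]
      | add t₁ t₂ h₁ h₂ => simp only [map_add, Pi.add_apply, h₁, h₂]
    have hνf : ν f' = 0 := by
      funext i
      rw [hν, Pi.zero_apply]
      apply hε_inj
      rw [← hcΦ]
      change c i g = 0
      rw [hg, map_zero]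
    exact hf'0 (hνinj (by rw [hνf, map_zero]))
  -- ### the eigenvalues and the conclusion
  let a' : (V →ₗ[C] V) → 𝒪' := fun T ↦ if hT : T ∈ 𝒯 then a'' (res ⟨T, hT⟩) else 0
  refine ⟨K', inferInstance, inferInstance, inferInstance, inferInstance, inferInstance, 𝒪',
    inferInstance, inferInstance, inferInstance, inferInstance, inferInstance, inferInstance,
    inferInstance, e, hcomap, he, a', g, hg0, hΦW f', fun T hT ↦ ?_, fun T hT ↦ ?_⟩
  · have h1 := hΦT ⟨T, hT⟩ f'
    rw [heig' (res ⟨T, hT⟩) ⟨_, rfl⟩, hΦsmul] at h1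
    change T g = ε (a' T) • g
    simp only [a', dif_pos hT]
    exact h1.symm
  · simp only [a', dif_pos hT]
    exact hcong' (res ⟨T, hT⟩) ⟨_, rfl⟩ (a T) (hαT ⟨T, hT⟩).symm

end Setting

end Literature.RingTheory.DiscreteValuationRing.DeligneSerre1974
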